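import Mathlib.Algebra.Order.Field.Basic
import Mathlib.Algebra.Order.BigOperators.Group.Finset
import Mathlib.Algebra.BigOperators.Ring.Finset
import Mathlib.Data.Rat.Defs
import Mathlib.Tactic.Linarith
import Mathlib.Tactic.FieldSimp
import Mathlib.Tactic.Ring
import Mathlib.Tactic.Positivity
import Mathlib.Tactic.NormNum
import HarnessLib

/-!
# R-H round-3 AXIS D1 «BED OPTIMUM» — the WITHIN-PLACE FINANCING LP of a place: value `min(MM, PP)`, dual prices `0/1`,
# «within ≤ across», and «across-place netting closes the datum iff idle surplus ≥ residual» (generic, exact ordered-field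
# arithmetic; PROOF-ONLY, 0 definitions)

abc-iut cell, rung LADDER-ABC:A2.RESCUE.H; seat abc-iut-rh2-xi-1 g9, KEY `wake/KEY-abc-iut-rh2-xi-1-D1-BED-FREY482.md` (21-frontier AXIS D
11:38:40Z / D-0130: «maximise kept fraction over ALL admissible combinations of the typed objects — slice choice, j₀, financing pattern
(within-place), partial-credit weights … subject to the kernel-certified constraints; report … which constraint is tight (dual prices)»).
This file is the KERNEL FACE of the LP that the D1 engines solve per place (rh2-xi-1 `engine_d1_bedopt.py`, kit j278691; rh2-xi-2 engine X;
rh-kit-1 and rh-kit-2), in the cell currency of TOPT LP-SPEC v1.2 §S2, §S3 (seats abc-iut-topt-lp-1 and topt-lp-2) — stated over ANY linearly ordered field `𝕜`.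

THE LP (one place `w`; cells `c ∈ s` = the labels `j`; DEMAND `d c ≥ 0` (`(f(j) − 1)·m_q`), certified DEFICIT `f c` with `0 ≤ f c ≤ d c`
(`(−margin_j)⁺`, so the certified COVERED SHARE is `d c − f c`), within-place BUDGET `C ≥ 0` (= `CC_w`, the licensed cells' surplus; FIN-REACH
p488873 / pv-3 p489258 «the within-place gain is `C_σ` exactly»)). A PLAN is a pair `(k, y)`: kept mass `0 ≤ k c ≤ d c` (slice choice and
partial-credit weight of the cell) and financing `0 ≤ y c` (j₀ raised past the licensed boundary by paying deficits), subject to the CELL-COVER rows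
`k c ≤ (d c − f c) + y c` and the BUDGET row `Σ_c y c ≤ C`. Value `V := max Σ_c k c`.
WHAT IS PROVED:
* §1 WEAK DUALITY `kept_le_min`: every plan keeps `≤ min(Σ d, Σ (d − f) + C)` (`= min(MM_w, PP_w)`, `PP = MM + CC − DD`).
* §2 ATTAINMENT `exists_plan_kept_eq_min`: some plan keeps exactly `min(Σ d, Σ (d − f) + C)` — all cells whole when the debt `Σ f` fits in `C`,
  otherwise PROPORTIONAL financing `y = (C/Σ f)·f` (no ranking of cells: the allocation is free, only the amount is forced). So `V = min(MM, PP)`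
  = tier L1a place by place (D-0121 FINAL item (5) r2; TOPT LP-SPEC §S3).
* §3 DUAL PRICES as sensitivities of `V(C) = min(D, P + C)`: one more unit of budget raises `V` by exactly `1` while `P + C < D` (BINDING place,
  `π_w = 1`: `value_add_eq_add_of_le`) and by `0` once `D ≤ P + C` (cap-tight place, `π_w = 0`: `value_add_eq_of_ge`); always `0 ≤ ΔV ≤ δ`
  (`value_mono_le`). This is the «λ ≡ 1» degeneracy of D-0121 item (1)(a) (pv-2 p488805 `RHToptKnapsackDual`, p490154 `…Degenerate`) in the
  (k, y) variables.
* §4 WITHIN ≤ ACROSS and the IDLE-SURPLUS CRITERION over a finite set of places `W`: `Σ_w min(D_w, P_w + C_w) ≤ min(Σ D, Σ P + Σ C)`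
  (`sum_min_le_min_sum`); the idle surplus `Σ_w (P_w + C_w − min(D_w, P_w + C_w)) = Σ_w (P_w + C_w − D_w)⁺` (`sum_idle_eq`), the residual
  `Σ_w (D_w − min(D_w, P_w + C_w)) = Σ_w (D_w − P_w − C_w)⁺` (`sum_residual_eq`), and ACROSS-PLACE NETTING CLOSES THE DATUM
  (`min(Σ D, Σ P + Σ C) = Σ D`) IFF residual ≤ idle surplus (`across_eq_total_iff`) — the D1 column «idle credit / residual ≥ 1 on every datum ⇒
  L1b = 1 on 482/482».
* §5 ONE WORKED PLACE of bed FREY482 (engine D1, kit j278691, `D1-deficit-places-print-v416.tsv` 1232c1726218c25f: the heaviest-loss binding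
  place, datum `pilotDataOfK:frey-466157462602565-…:17`, `p = 13`, `e_w = 85`, `m_q = 45` (scaled by `Z = 2`): `MM = 35280`, `CC = 1080`,
  `DD = 22544`): `min(MM, MM + CC − DD) = 13816`, loss `(DD − CC)/MM = 2683/4410 ≈ 0.608` — arithmetic `example`s only (computed ≠ proved: the
  link «integers ↔ datum» is the kit manifest).
HONEST FRAMING: elementary LP arithmetic about a finite table of numbers; nothing here asserts that abc is proved or refuted, or that
[IUTchIII] Cor. 3.12 / [IUTchIV] Thm. 1.10 holds or fails at any datum, or takes a side on any author; a weight law / knob setting of the axis-B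
table is a parameter change in OUR typed cell currency, never a claim about IUT; typed ≠ proved. [folklore] throughout (LP duality for a
single-budget transportation row; Dantzig 1951).
-/

namespace Summit.ABC.IUTFork.Repair.RH.BedOptimum

open Finset

variable {ι 𝕜 : Type*} [Field 𝕜] [LinearOrder 𝕜] [IsStrictOrderedRing 𝕜]

/-! ## §1. Weak duality: every plan keeps at most `min(MM, PP)` -/

section WeakDuality

variable {s : Finset ι} {d f k y : ι → 𝕜} {C : 𝕜}

/-- A plan keeps at most the total demand `MM = Σ d` (the cap rows `k c ≤ d c`). [folklore] -/
theorem kept_le_demand (hkd : ∀ c ∈ s, k c ≤ d c) : ∑ c ∈ s, k c ≤ ∑ c ∈ s, d c :=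
  Finset.sum_le_sum hkd

/-- A plan keeps at most covered share plus budget `PP = Σ (d − f) + C` (the cell-cover rows summed, then the budget row). [folklore] -/
theorem kept_le_covered_add_budget (hcov : ∀ c ∈ s, k c ≤ d c - f c + y c) (hbud : ∑ c ∈ s, y c ≤ C) :
    ∑ c ∈ s, k c ≤ ∑ c ∈ s, (d c - f c) + C := by
  have h1 : ∑ c ∈ s, k c ≤ ∑ c ∈ s, (d c - f c + y c) := Finset.sum_le_sum hcov
  rw [Finset.sum_add_distrib] at h1
  linarith

/-- **WEAK DUALITY.** Every plan keeps at most `min(MM, PP)` with `MM = Σ d`, `PP = Σ (d − f) + C`. [folklore] -/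
theorem kept_le_min (hkd : ∀ c ∈ s, k c ≤ d c) (hcov : ∀ c ∈ s, k c ≤ d c - f c + y c) (hbud : ∑ c ∈ s, y c ≤ C) :
    ∑ c ∈ s, k c ≤ min (∑ c ∈ s, d c) (∑ c ∈ s, (d c - f c) + C) :=
  le_min (kept_le_demand hkd) (kept_le_covered_add_budget hcov hbud)

omit [LinearOrder 𝕜] [IsStrictOrderedRing 𝕜] in
/-- `PP` in the engines' form: `Σ (d − f) + C = Σ d + C − Σ f` (`PP = MM + CC − DD`). [folklore] -/
theorem covered_add_budget_eq : ∑ c ∈ s, (d c - f c) + C = ∑ c ∈ s, d c + C - ∑ c ∈ s, f c := by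
  rw [Finset.sum_sub_distrib]
  ring

end WeakDuality

/-! ## §2. Attainment: `V = min(MM, PP)`, by keeping everything or by proportional financing -/

section Attainment

variable {s : Finset ι} {d f : ι → 𝕜} {C : 𝕜}

/-- **ATTAINMENT / STRONG DUALITY IN CLOSED FORM.** For demands `d`, certified deficits `0 ≤ f ≤ d` and a budget `C ≥ 0` there is a feasible plan
`(k, y)` (`0 ≤ k ≤ d`, `0 ≤ y ≤ f`, `k ≤ (d − f) + y`, `Σ y ≤ C`) keeping exactly `min(Σ d, Σ (d − f) + C)`: if the debt `Σ f` fits in `C`, finance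
every deficit in full and keep every cell whole; otherwise finance the fraction `θ = C/Σ f ∈ [0, 1)` of EVERY deficit (proportional financing —
the lowest-label-first, highest-label-first and proportional allocations all attain the value; only the total is forced). [folklore] -/
theorem exists_plan_kept_eq_min (hf0 : ∀ c ∈ s, 0 ≤ f c) (hfd : ∀ c ∈ s, f c ≤ d c) (hC : 0 ≤ C) :
    ∃ k y : ι → 𝕜, (∀ c ∈ s, 0 ≤ k c) ∧ (∀ c ∈ s, k c ≤ d c) ∧ (∀ c ∈ s, 0 ≤ y c) ∧ (∀ c ∈ s, y c ≤ f c) ∧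
      (∀ c ∈ s, k c ≤ d c - f c + y c) ∧ ∑ c ∈ s, y c ≤ C ∧
        ∑ c ∈ s, k c = min (∑ c ∈ s, d c) (∑ c ∈ s, (d c - f c) + C) := by
  by_cases hdebt : ∑ c ∈ s, f c ≤ C
  · -- the debt fits: `k = d`, `y = f`
    refine ⟨d, f, fun c hc => le_trans (hf0 c hc) (hfd c hc), fun c _ => le_rfl, hf0, fun c _ => le_rfl,
      fun c _ => by linarith, hdebt, ?_⟩
    rw [min_eq_left]
    rw [Finset.sum_sub_distrib]
    linarith
  · -- the debt exceeds the budget: proportional financing `y = θ•f`, `θ = C / Σ f`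
    push Not at hdebt
    have hF : 0 < ∑ c ∈ s, f c := lt_of_le_of_lt hC hdebt
    set θ : 𝕜 := C / ∑ c ∈ s, f c with hθ
    have hθ0 : 0 ≤ θ := div_nonneg hC hF.le
    have hθ1 : θ ≤ 1 := (div_le_one hF).mpr hdebt.le
    have hθF : θ * ∑ c ∈ s, f c = C := div_mul_cancel₀ _ hF.ne'
    have hθf : ∀ c ∈ s, θ * f c ≤ f c := fun c hc => by
      have h := mul_le_mul_of_nonneg_right hθ1 (hf0 c hc)
      rwa [one_mul] at h
    refine ⟨fun c => d c - f c + θ * f c, fun c => θ * f c, fun c hc => ?_, fun c hc => ?_, fun c hc => mul_nonneg hθ0 (hf0 c hc),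
      hθf, fun c _ => le_rfl, ?_, ?_⟩
    · have h1 := hfd c hc
      have h2 := mul_nonneg hθ0 (hf0 c hc)
      linarith
    · have h1 := hθf c hc
      linarith
    · rw [← Finset.mul_sum, hθF]
    · have hlt : ∑ c ∈ s, (d c - f c) + C < ∑ c ∈ s, d c := by
        rw [Finset.sum_sub_distrib]
        linarith
      rw [min_eq_right hlt.le, Finset.sum_add_distrib, ← Finset.mul_sum, hθF]

/-- **THE VALUE.** Combining §1 and §2: `min(Σ d, Σ (d − f) + C)` is the MAXIMUM kept mass over all plans — attained, and exceeded by no plan.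
(`V_w = min(MM_w, PP_w)`: tier L1a of TOPT LP-SPEC §S3, place by place.) [folklore] -/
theorem value_eq_min (hf0 : ∀ c ∈ s, 0 ≤ f c) (hfd : ∀ c ∈ s, f c ≤ d c) (hC : 0 ≤ C) :
    (∃ k y : ι → 𝕜, (∀ c ∈ s, 0 ≤ k c) ∧ (∀ c ∈ s, k c ≤ d c) ∧ (∀ c ∈ s, 0 ≤ y c) ∧ (∀ c ∈ s, y c ≤ f c) ∧
      (∀ c ∈ s, k c ≤ d c - f c + y c) ∧ ∑ c ∈ s, y c ≤ C ∧
        ∑ c ∈ s, k c = min (∑ c ∈ s, d c) (∑ c ∈ s, (d c - f c) + C)) ∧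
    ∀ k y : ι → 𝕜, (∀ c ∈ s, k c ≤ d c) → (∀ c ∈ s, k c ≤ d c - f c + y c) → ∑ c ∈ s, y c ≤ C →
      ∑ c ∈ s, k c ≤ min (∑ c ∈ s, d c) (∑ c ∈ s, (d c - f c) + C) :=
  ⟨exists_plan_kept_eq_min hf0 hfd hC, fun _ _ hkd hcov hbud => kept_le_min hkd hcov hbud⟩

end Attainment

/-! ## §3. Dual prices: the sensitivity of `V(C) = min(D, P + C)` in the budget is `1` on binding places and `0` on cap-tight ones -/

section Prices

variable {D P C δ : 𝕜}

/-- **PRICE 1 (binding budget, `π_w = 1`).** While `P + C + δ ≤ D`, an extra budget `δ ≥ 0` is kept one for one: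
`V(C + δ) = V(C) + δ`. [folklore] -/
theorem value_add_eq_add_of_le (h : P + C + δ ≤ D) (hδ : 0 ≤ δ) :
    min D (P + (C + δ)) = min D (P + C) + δ := by
  rw [min_eq_right (by linarith), min_eq_right (by linarith)]
  ring

/-- **PRICE 0 (cap-tight place, `π_w = 0`).** Once `D ≤ P + C`, extra budget `δ ≥ 0` keeps nothing more: `V(C + δ) = V(C) = D`. [folklore] -/
theorem value_add_eq_of_ge (h : D ≤ P + C) (hδ : 0 ≤ δ) : min D (P + (C + δ)) = min D (P + C) := by
  rw [min_eq_left h, min_eq_left (by linarith)]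

/-- In general the budget sensitivity is between `0` and `1`: `0 ≤ V(C + δ) − V(C) ≤ δ` for `δ ≥ 0` (the price is `1` then `0`, never more:
no combination of slice / j₀ / partial-credit choices makes a unit of within-place surplus worth more than one unit of kept mass). [folklore] -/
theorem value_mono_le (hδ : 0 ≤ δ) :
    0 ≤ min D (P + (C + δ)) - min D (P + C) ∧ min D (P + (C + δ)) - min D (P + C) ≤ δ := by
  rcases le_total D (P + C) with h | h
  · rw [min_eq_left h, min_eq_left (by linarith : D ≤ P + (C + δ))]
    constructor <;> linarith
  · rw [min_eq_right h]
    rcases le_total D (P + (C + δ)) with h' | h'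
    · rw [min_eq_left h']
      constructor <;> linarith
    · rw [min_eq_right h']
      constructor <;> linarith

/-- The place is BINDING (`V < D`, some demand is not kept) iff its deficit exceeds its surplus in the engines' integers: with `P = D − F`
(`F = Σ f = DD`), `min(D, D − F + C) < D ↔ C < F` (`CC_w < DD_w`). [folklore] -/
theorem binding_iff {F : 𝕜} : min D (D - F + C) < D ↔ C < F := by
  constructor
  · intro h
    by_contra hle
    push Not at hle
    have : min D (D - F + C) = D := min_eq_left (by linarith)
    linarith
  · intro h
    rw [min_eq_right (by linarith)]
    linarith

end Prices

/-! ## §4. A finite set of places: within ≤ across, idle surplus, residual, and when across-place netting closes the datum -/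

section Across

variable {α : Type*} {W : Finset α} {D P C : α → 𝕜}

/-- **WITHIN ≤ ACROSS.** Netting each place against its own budget keeps at most what one pooled budget keeps:
`Σ_w min(D_w, P_w + C_w) ≤ min(Σ_w D_w, Σ_w P_w + Σ_w C_w)` (tier L1a ≤ tier L1b). [folklore] -/
theorem sum_min_le_min_sum :
    ∑ w ∈ W, min (D w) (P w + C w) ≤ min (∑ w ∈ W, D w) (∑ w ∈ W, P w + ∑ w ∈ W, C w) := by
  refine le_min (Finset.sum_le_sum fun w _ => min_le_left _ _) ?_
  rw [← Finset.sum_add_distrib]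
  exact Finset.sum_le_sum fun w _ => min_le_right _ _

/-- One place: the IDLE surplus `P + C − min(D, P + C) = (P + C − D)⁺`. [folklore] -/
theorem add_sub_min_eq_posPart (D P C : 𝕜) : P + C - min D (P + C) = max (P + C - D) 0 := by
  rcases le_total D (P + C) with h | h
  · rw [min_eq_left h, max_eq_left (by linarith)]
  · rw [min_eq_right h, max_eq_right (by linarith)]
    ring

/-- One place: the RESIDUAL `D − min(D, P + C) = (D − (P + C))⁺`. [folklore] -/
theorem sub_min_eq_posPart (D P C : 𝕜) : D - min D (P + C) = max (D - (P + C)) 0 := by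
  rcases le_total D (P + C) with h | h
  · rw [min_eq_left h, max_eq_right (by linarith)]
    ring
  · rw [min_eq_right h, max_eq_left (by linarith)]

/-- **IDLE SURPLUS of the within-place optimum** summed over places: `Σ_w (P_w + C_w) − Σ_w min(D_w, P_w + C_w) = Σ_w (P_w + C_w − D_w)⁺`
(the certified surplus sitting at cap-tight places, which within-place netting cannot move; engine column `idle_credit`). [folklore] -/
theorem sum_idle_eq :
    ∑ w ∈ W, (P w + C w) - ∑ w ∈ W, min (D w) (P w + C w) = ∑ w ∈ W, max (P w + C w - D w) 0 := by
  rw [← Finset.sum_sub_distrib]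
  exact Finset.sum_congr rfl fun w _ => add_sub_min_eq_posPart _ _ _

/-- **RESIDUAL of the within-place optimum** summed over places: `Σ_w D_w − Σ_w min(D_w, P_w + C_w) = Σ_w (D_w − P_w − C_w)⁺`
(what the last per-cents are made of: one term per BINDING place; engine column `resid_L1a`). [folklore] -/
theorem sum_residual_eq :
    ∑ w ∈ W, D w - ∑ w ∈ W, min (D w) (P w + C w) = ∑ w ∈ W, max (D w - (P w + C w)) 0 := by
  rw [← Finset.sum_sub_distrib]
  exact Finset.sum_congr rfl fun w _ => sub_min_eq_posPart _ _ _

/-- `x = x⁺ − (−x)⁺`, in the form used below. [folklore] -/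
theorem sub_posPart_eq (x : 𝕜) : max x 0 - max (-x) 0 = x := by
  rcases le_total 0 x with h | h
  · rw [max_eq_left h, max_eq_right (by linarith)]
    ring
  · rw [max_eq_right h, max_eq_left (by linarith)]
    ring

/-- **ACROSS-PLACE NETTING CLOSES THE DATUM IFF IDLE SURPLUS ≥ RESIDUAL.** `min(Σ D, Σ P + Σ C) = Σ D` (tier L1b keeps everything) iff
`Σ_w (D_w − P_w − C_w)⁺ ≤ Σ_w (P_w + C_w − D_w)⁺` (the binding places' residual is covered by the cap-tight places' idle surplus) — the D1 column
«idle credit / residual ≥ 1» (20.9 × pooled on FREY482; ≥ 1 on every one of the 482 data, hence L1b = 1 on 482/482). [folklore] -/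
theorem across_eq_total_iff :
    min (∑ w ∈ W, D w) (∑ w ∈ W, P w + ∑ w ∈ W, C w) = ∑ w ∈ W, D w ↔
      ∑ w ∈ W, max (D w - (P w + C w)) 0 ≤ ∑ w ∈ W, max (P w + C w - D w) 0 := by
  have key : ∑ w ∈ W, max (D w - (P w + C w)) 0 - ∑ w ∈ W, max (P w + C w - D w) 0 =
      ∑ w ∈ W, D w - (∑ w ∈ W, P w + ∑ w ∈ W, C w) := by
    rw [← Finset.sum_sub_distrib, ← Finset.sum_add_distrib, ← Finset.sum_sub_distrib]
    refine Finset.sum_congr rfl fun w _ => ?_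
    have h := sub_posPart_eq (D w - (P w + C w))
    rw [show -(D w - (P w + C w)) = P w + C w - D w by ring] at h
    exact h
  constructor
  · intro h
    have hle : ∑ w ∈ W, D w ≤ ∑ w ∈ W, P w + ∑ w ∈ W, C w := by
      rw [← h]
      exact min_le_right _ _
    linarith
  · intro h
    exact min_eq_left (by linarith)

end Across

/-! ## §5. One worked binding place of bed FREY482 (engine D1, kit j278691; integers scaled by `Z = 2`) -/

section WorkedPlace

/-- The heaviest-loss binding place of FREY482 (datum `…frey-466157462602565-…:17`, `p = 13`, `e_w = 85`, `l⋆ = 8`): `MM = 35280`, `CC = 1080`,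
`DD = 22544`; the within-place optimum keeps `min(MM, MM + CC − DD) = 13816` (`Z`-scaled units of `ln 13/(e_w·l⋆·Z)` nats). Arithmetic only;
the link «integers ↔ datum» is the kit manifest (computed ≠ proved). -/
example : min (35280 : ℚ) (35280 + 1080 - 22544) = 13816 := by norm_num

/-- … its place is BINDING (`CC < DD`, price `π_w = 1`) and loses the fraction `(DD − CC)/MM = 21464/35280 = 2683/4410` (≈ 0.608, the bed maximum). -/
example : (1080 : ℚ) < 22544 ∧ ((22544 : ℚ) - 1080) / 35280 = 2683 / 4410 := by norm_num

/-- … and §3's criterion at these integers: `min(MM, MM − DD + CC) < MM ↔ CC < DD`, here both sides true. -/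
example : min (35280 : ℚ) (35280 - 22544 + 1080) < 35280 := by
  rw [binding_iff]
  norm_num

end WorkedPlace

end Summit.ABC.IUTFork.Repair.RH.BedOptimum
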